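import Literature.NumberTheory.LFunctions.RealZeroLOneLowerBoundExplicit
import Literature.NumberTheory.LFunctions.DirichletLDerivativeLogSqBound
import Literature.NumberTheory.QuadraticFields.RealQuadraticUnits
import Literature.NumberTheory.QuadraticFields.FundamentalDiscriminant
import Literature.Barriers.Parity.SiegelZeroDichotomy
import HarnessLib

/-!
# I.1, EVEN parity: `h_K · R_K` of the exceptional REAL quadratic field under a real zero —
# `0.405 √q (1−β) ≤ h_K R_K ≤ ½ √q (log q)² (1−β)`, kernel, explicit, fact-free

Topic `Literature/NumberTheory/LFunctions` (namespace `Literature.NumberTheory.LFunctions`). Everything in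
this file is PROVED (theorems only; no definition, no named fact, debt 0). Cell `parity-realchar`
(SIEGEL INSTRUMENT, conditionals column, topic I.1 «class numbers»): the EVEN-character column of the
kernel I.1 line. The odd column (imaginary quadratic `K`, `h_K` alone) is
`classNumber_two_sided_of_realZero_explicit` / `classNumber_bounds_of_isSiegelZero`
(`RealZeroLOneLowerBoundExplicit.lean`); for an EVEN primitive quadratic character the field `K = ℚ(√q)`
is REAL quadratic and Dirichlet's class number formula reads `L(1, χ_{d_K}) = 4 h_K R_K/(w_K √d_K) =
2 h_K R_K/√d_K` (`w_K = 2`; tree: `Quadratic.LFunction_jacobiChar_one_eq_of_discr_pos`,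
`Quadratic.torsionOrder_eq_two_of_discr_pos`), so the «small class number» of the illusory world becomes
«small `h_K R_K`» (Siegel's theorem in its classical real-quadratic form `h_K log ε_K ~ …`). With the
kernel's explicit two halves of Montgomery–Vaughan (11.10) — `L(1,χ) ≥ 0.81 (1 − β)` at a real zero
`β ≥ 1 − 1/(10 log q)`, `q ≥ 10⁴` (`RealZeroRepulsion.lOne_ge_of_realZero_tenth`) and
`L(1,χ) ≤ (1 − β)(log q)²` at `β ≥ 1 − 1/(40 log q)`, `q ≥ 232`
(`DirichletAbel.norm_LFunction_one_le_log_sq_of_realZero`), resp. `≤ 55 (1−β)(log q)²` on the wider window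
`1/(4 log q)` (`RealZeroRepulsion.norm_LFunction_one_le_mul_log_sq`):

* `classNumber_mul_regulator_ge_of_realZero_explicit` — real quadratic `K`, odd `d_K = q ≥ 10⁴`, real
  zero `β ≥ 1 − 1/(10 log q)` of `L(s, χ_{d_K})`: **`0.405 √q (1 − β) ≤ h_K R_K`**;
* `classNumber_mul_regulator_le_of_realZero_explicit` — `q ≥ 232`, `β ≥ 1 − 1/(40 log q)`:
  **`h_K R_K ≤ ½ √q (log q)² (1 − β)`**; `…_le_of_realZero_quarter` — `β ≥ 1 − 1/(4 log q)`:
  `h_K R_K ≤ (55/2) √q (log q)² (1 − β)`;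
* `classNumber_mul_regulator_two_sided_of_realZero_explicit` — both at once (`q ≥ 10⁴`, window `1/40`);
* `classNumber_mul_regulator_bounds_of_isSiegelZero` — on the column's predicate: a Tao–Teräväinen
  Siegel zero of quality `η` (`η ≥ 10`) at `χ_{d_K} = jacobiChar q`, `q ≥ 10⁴`:
  **`0.405 √q/(η log q) ≤ h_K R_K ≤ (55/2) √q log q/η`**, and `≤ √q log q/(2η)` once `η ≥ 40`
  (`…_le_of_isSiegelZero_of_forty_le`).

Only ODD positive discriminants are treated (the Kronecker character is then the tree's `jacobiChar d_K`,
primitive of conductor `d_K`); `-- TODO(general form): even d_K > 0 via the Kronecker character mod d_K`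
(the character-side bridge `exists_numberField_discr_eq` of `RealZeroEffectiveRepulsionEven.lean`).
Print comparators: none specific to `h_K R_K` in the column's sources (BGTZ Lemma 2.9 is character-side:
`0.72 ≤ L(1,χ₁)/(1−β₁) ≤ 0.18 log²q`, `q > 4·10⁵`).

LABEL (cell rule): instrument (kernel) / conditionals I.1 even column. WHAT THIS IS NOT: no claim that a
real zero exists; no separation of `h_K` from `R_K` (that would need a regulator UPPER bound, i.e. the
size of the fundamental unit, which is not controlled by `d_K` polynomially); nothing here bears on parity.

## References

* [NeukirchANT1999] Ch. VII §5 (5.11) (class number formula; real quadratic case as proved in the tree).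
* [MontgomeryVaughan2007] §11.2 Theorem 11.4 (11.10) (both halves, kernel versions cited above).
* [BenliGoelTwissZaman2025] Lemma 2.9 (print comparator, character side).
* [TaoTeravainen2021] Definition 1.4 (`IsSiegelZero`).
-/

noncomputable section

open Complex
open Literature.Barriers.Parity
open Literature.NumberTheory.QuadraticFields Literature.NumberTheory.QuadraticFields.Quadratic
open _root_.NumberField _root_.NumberField.Units Module

namespace Literature.NumberTheory.LFunctions

variable {K : Type*} [Field K] [NumberField K]

/-- `log q ≥ 9` for `q ≥ 10⁴`. [folklore] -/
private theorem nine_le_log_of_ge {q : ℕ} (hq : 10 ^ 4 ≤ q) : (9 : ℝ) ≤ Real.log q := by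
  have hq' : (10 : ℝ) ^ 4 ≤ q := by exact_mod_cast hq
  rw [Real.le_log_iff_exp_le (by linarith)]
  have h1 : Real.exp 9 = Real.exp 1 ^ 9 := by rw [← Real.exp_nat_mul]; norm_num
  rw [h1]
  calc Real.exp 1 ^ 9 ≤ 2.7182818286 ^ 9 :=
        pow_le_pow_left₀ (Real.exp_pos 1).le Real.exp_one_lt_d9.le 9
    _ ≤ (10 : ℝ) ^ 4 := by norm_num
    _ ≤ q := hq'

/-- For a REAL quadratic field with odd discriminant `d_K = q`: `jacobiChar q` is primitive, `w_K = 2`,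
and the class number formula in real form `Re L(1, χ_{d_K}) = 2 h_K R_K/√q`, with `|d_K| = q` as a
natural number. [cite: NeukirchANT1999, Ch. VII §5 (5.11)] -/
private theorem realQuadratic_basic (h2 : finrank ℚ K = 2) (hodd : Odd (NumberField.discr K))
    (hd : 0 < NumberField.discr K) :
    (jacobiChar (NumberField.discr K).natAbs).IsPrimitive ∧
      ((jacobiChar (NumberField.discr K).natAbs).LFunction 1).re =
        2 * classNumber K * regulator K / Real.sqrt (NumberField.discr K).natAbs := by
  have hoddN : Odd (NumberField.discr K).natAbs := Int.natAbs_odd.mpr hodd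
  have hsqN : Squarefree (NumberField.discr K).natAbs := by
    rcases isFundamentalDiscriminant_discr (K := K) h2 with ⟨-, hsqf, -⟩ | ⟨h4, -, -⟩
    · exact Int.squarefree_natAbs.mpr hsqf
    · exfalso
      rcases hodd with ⟨k, hk⟩
      omega
  refine ⟨isPrimitive_jacobiChar hoddN hsqN, ?_⟩
  have hcnf := LFunction_jacobiChar_one_eq_of_discr_pos h2 hodd hd
  have hcast : ((NumberField.discr K : ℤ) : ℝ) = ((NumberField.discr K).natAbs : ℝ) := by
    rw [← Int.cast_natCast, Int.natAbs_of_nonneg hd.le]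
  rw [torsionOrder_eq_two_of_discr_pos h2 hd, hcast] at hcnf
  rw [hcnf, Complex.ofReal_re]
  push_cast
  ring

/-! ### Lower half: `h_K R_K ≥ 0.405 √q (1 − β)` -/

/-- **`h_K R_K ≥ 0.405 √q (1 − β)` (kernel, fact-free).** For a real quadratic field `K` with odd
`d_K = q ≥ 10⁴` and a real zero `β ≥ 1 − 1/(10 log q)` of `L(s, χ_{d_K})` (`χ_{d_K} = jacobiChar q`,
even primitive quadratic): the class number formula `L(1,χ_{d_K}) = 2 h_K R_K/√q` and the kernel bound
`L(1,χ) ≥ 0.81 (1 − β)`. [cite: NeukirchANT1999, Ch. VII §5 (5.11)]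
[cite: MontgomeryVaughan2007, §11.2 Theorem 11.4 (11.10)] -/
theorem classNumber_mul_regulator_ge_of_realZero_explicit (h2 : finrank ℚ K = 2)
    (hodd : Odd (NumberField.discr K)) (hd : 0 < NumberField.discr K)
    (hq : 10 ^ 4 ≤ (NumberField.discr K).natAbs) {β : ℝ}
    (hβ : 1 - 1 / (10 * Real.log (NumberField.discr K).natAbs) ≤ β)
    (hz : (jacobiChar (NumberField.discr K).natAbs).LFunction β = 0) :
    0.405 * Real.sqrt (NumberField.discr K).natAbs * (1 - β) ≤ (classNumber K : ℝ) * regulator K := by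
  haveI : NeZero (NumberField.discr K).natAbs := ⟨by omega⟩
  obtain ⟨hprim, hre⟩ := realQuadratic_basic h2 hodd hd
  have hlow := RealZeroRepulsion.lOne_ge_of_realZero_tenth (jacobiChar (NumberField.discr K).natAbs)
    hq hprim isQuadratic_jacobiChar hz hβ
  have hs0 : (0 : ℝ) < Real.sqrt ((NumberField.discr K).natAbs : ℝ) :=
    Real.sqrt_pos.mpr (by exact_mod_cast (show 0 < (NumberField.discr K).natAbs by omega))
  rw [hre, le_div_iff₀ hs0] at hlow
  linarith

/-! ### Upper half: `h_K R_K ≤ ½ √q (log q)² (1 − β)` -/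

/-- **`h_K R_K ≤ ½ √q (log q)² (1 − β)` (kernel, fact-free).** For a real quadratic field `K` with odd
`d_K = q ≥ 232` and a real zero `β ≥ 1 − 1/(40 log q)` of `L(s, χ_{d_K})`: the class number formula and
the kernel's explicit upper half of (11.10), `‖L(1,χ)‖ ≤ (1 − β)(log q)²`.
[cite: NeukirchANT1999, Ch. VII §5 (5.11)] [cite: MontgomeryVaughan2007, §11.2 Theorem 11.4 (11.10)] -/
theorem classNumber_mul_regulator_le_of_realZero_explicit (h2 : finrank ℚ K = 2)
    (hodd : Odd (NumberField.discr K)) (hd : 0 < NumberField.discr K)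
    (hq : 232 ≤ (NumberField.discr K).natAbs) {β : ℝ}
    (hβ : 1 - 1 / (40 * Real.log (NumberField.discr K).natAbs) ≤ β)
    (hz : (jacobiChar (NumberField.discr K).natAbs).LFunction β = 0) :
    (classNumber K : ℝ) * regulator K ≤
      1 / 2 * Real.sqrt (NumberField.discr K).natAbs * Real.log (NumberField.discr K).natAbs ^ 2 *
        (1 - β) := by
  haveI : NeZero (NumberField.discr K).natAbs := ⟨by omega⟩
  obtain ⟨hprim, hre⟩ := realQuadratic_basic h2 hodd hd
  have hup := DirichletAbel.norm_LFunction_one_le_log_sq_of_realZero hq hprim hβ hz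
  have hre_le : ((jacobiChar (NumberField.discr K).natAbs).LFunction 1).re ≤
      (1 - β) * Real.log (NumberField.discr K).natAbs ^ 2 := (Complex.re_le_norm _).trans hup
  have hs0 : (0 : ℝ) < Real.sqrt ((NumberField.discr K).natAbs : ℝ) :=
    Real.sqrt_pos.mpr (by exact_mod_cast (show 0 < (NumberField.discr K).natAbs by omega))
  rw [hre, div_le_iff₀ hs0] at hre_le
  linarith

/-- **The wide window**: for a real quadratic `K` with odd `d_K = q ≥ 8` and a real zero
`β ≥ 1 − 1/(4 log q)` of `L(s,χ_{d_K})`: `h_K R_K ≤ (55/2) √q (log q)² (1 − β)` (the cruder kernel upper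
half `‖L(1,χ)‖ ≤ 55 (1−β)(log q)²` on the wide window, `RealZeroRepulsion.norm_LFunction_one_le_mul_log_sq`).
[cite: NeukirchANT1999, Ch. VII §5 (5.11)] [cite: MontgomeryVaughan2007, §11.2 Theorem 11.4 (11.10)] -/
theorem classNumber_mul_regulator_le_of_realZero_quarter (h2 : finrank ℚ K = 2)
    (hodd : Odd (NumberField.discr K)) (hd : 0 < NumberField.discr K)
    (hq : 8 ≤ (NumberField.discr K).natAbs) {β : ℝ}
    (hβ : 1 - 1 / (4 * Real.log (NumberField.discr K).natAbs) ≤ β)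
    (hz : (jacobiChar (NumberField.discr K).natAbs).LFunction β = 0) :
    (classNumber K : ℝ) * regulator K ≤
      55 / 2 * Real.sqrt (NumberField.discr K).natAbs * Real.log (NumberField.discr K).natAbs ^ 2 *
        (1 - β) := by
  haveI : NeZero (NumberField.discr K).natAbs := ⟨by omega⟩
  obtain ⟨hprim, hre⟩ := realQuadratic_basic h2 hodd hd
  have hne : jacobiChar (NumberField.discr K).natAbs ≠ 1 := by
    intro h
    rw [DirichletCharacter.isPrimitive_def, h, DirichletCharacter.conductor_one] at hprim
    omega
  have hup := RealZeroRepulsion.norm_LFunction_one_le_mul_log_sq hq _ hne hβ hz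
  have hre_le : ((jacobiChar (NumberField.discr K).natAbs).LFunction 1).re ≤
      55 * (1 - β) * Real.log (NumberField.discr K).natAbs ^ 2 := (Complex.re_le_norm _).trans hup
  have hs0 : (0 : ℝ) < Real.sqrt ((NumberField.discr K).natAbs : ℝ) :=
    Real.sqrt_pos.mpr (by exact_mod_cast (show 0 < (NumberField.discr K).natAbs by omega))
  rw [hre, div_le_iff₀ hs0] at hre_le
  linarith

/-- **Two-sided, kernel**: for a real quadratic `K`, odd `d_K = q ≥ 10⁴`, and a real zero
`β ≥ 1 − 1/(40 log q)` of `L(s,χ_{d_K})`: `0.405 √q (1−β) ≤ h_K R_K ≤ ½ √q (log q)² (1−β)`.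
[cite: NeukirchANT1999, Ch. VII §5 (5.11)] [cite: MontgomeryVaughan2007, §11.2 Theorem 11.4 (11.10)] -/
theorem classNumber_mul_regulator_two_sided_of_realZero_explicit (h2 : finrank ℚ K = 2)
    (hodd : Odd (NumberField.discr K)) (hd : 0 < NumberField.discr K)
    (hq : 10 ^ 4 ≤ (NumberField.discr K).natAbs) {β : ℝ}
    (hβ : 1 - 1 / (40 * Real.log (NumberField.discr K).natAbs) ≤ β)
    (hz : (jacobiChar (NumberField.discr K).natAbs).LFunction β = 0) :
    0.405 * Real.sqrt (NumberField.discr K).natAbs * (1 - β) ≤ (classNumber K : ℝ) * regulator K ∧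
      (classNumber K : ℝ) * regulator K ≤
        1 / 2 * Real.sqrt (NumberField.discr K).natAbs * Real.log (NumberField.discr K).natAbs ^ 2 *
          (1 - β) := by
  have hL9 : 9 ≤ Real.log (NumberField.discr K).natAbs := nine_le_log_of_ge hq
  have hβ10 : 1 - 1 / (10 * Real.log (NumberField.discr K).natAbs) ≤ β := by
    have : 1 / (40 * Real.log (NumberField.discr K).natAbs) ≤
        1 / (10 * Real.log (NumberField.discr K).natAbs) :=
      one_div_le_one_div_of_le (by positivity) (by linarith)
    linarith
  exact ⟨classNumber_mul_regulator_ge_of_realZero_explicit h2 hodd hd hq hβ10 hz,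
    classNumber_mul_regulator_le_of_realZero_explicit h2 hodd hd (le_trans (by norm_num) hq) hβ hz⟩

/-! ### On the column's predicate: a Siegel zero of quality `η` pins `h_K R_K` -/

/-- **`h_K R_K` of the exceptional real quadratic field under a Siegel zero of quality `η` (kernel).** For
a real quadratic `K` with odd `d_K = q ≥ 10⁴` whose Kronecker character `χ_{d_K} = jacobiChar q` carries
a Tao–Teräväinen Siegel zero of quality `η` (`η ≥ 10`, `L(1 − 1/(η log q), χ_{d_K}) = 0`):
`0.405 √q/(η log q) ≤ h_K R_K ≤ (55/2) √q log q/η` (lower half on the window `1/(10 log q)` since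
`η ≥ 10`, upper half on the window `1/(4 log q)`). The «small `h log ε`» of the illusory world with its
floor. [cite: TaoTeravainen2021, Definition 1.4] [cite: NeukirchANT1999, Ch. VII §5 (5.11)]
[cite: MontgomeryVaughan2007, §11.2 Theorem 11.4 (11.10)] -/
theorem classNumber_mul_regulator_bounds_of_isSiegelZero (h2 : finrank ℚ K = 2)
    (hodd : Odd (NumberField.discr K)) (hd : 0 < NumberField.discr K)
    [NeZero (NumberField.discr K).natAbs] (hq : 10 ^ 4 ≤ (NumberField.discr K).natAbs) {η : ℝ}
    (hS : IsSiegelZero (jacobiChar (NumberField.discr K).natAbs) η) :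
    0.405 * Real.sqrt (NumberField.discr K).natAbs / (η * Real.log (NumberField.discr K).natAbs) ≤
        (classNumber K : ℝ) * regulator K ∧
      (classNumber K : ℝ) * regulator K ≤
        55 / 2 * Real.sqrt (NumberField.discr K).natAbs * Real.log (NumberField.discr K).natAbs / η := by
  set q : ℕ := (NumberField.discr K).natAbs with hqdef
  obtain ⟨-, -, h10, hzero⟩ := hS
  have hL9 : 9 ≤ Real.log q := nine_le_log_of_ge hq
  have hL0 : 0 < Real.log q := by linarith
  have hη0 : 0 < η := by linarith
  set β : ℝ := 1 - 1 / (η * Real.log q) with hβdef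
  have hκ : 1 - β = 1 / (η * Real.log q) := by rw [hβdef]; ring
  have hβ10 : 1 - 1 / (10 * Real.log q) ≤ β := by
    have : 1 / (η * Real.log q) ≤ 1 / (10 * Real.log q) :=
      one_div_le_one_div_of_le (by positivity) (mul_le_mul_of_nonneg_right h10 hL0.le)
    rw [hβdef]; linarith
  have hβ4 : 1 - 1 / (4 * Real.log q) ≤ β := by
    have : 1 / (10 * Real.log q) ≤ 1 / (4 * Real.log q) :=
      one_div_le_one_div_of_le (by positivity) (by linarith)
    linarith
  have hlo := classNumber_mul_regulator_ge_of_realZero_explicit h2 hodd hd hq hβ10 hzero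
  have hhi := classNumber_mul_regulator_le_of_realZero_quarter h2 hodd hd (le_trans (by norm_num) hq)
    hβ4 hzero
  rw [hκ] at hlo hhi
  constructor
  · calc 0.405 * Real.sqrt q / (η * Real.log q) = 0.405 * Real.sqrt q * (1 / (η * Real.log q)) := by
          ring
      _ ≤ (classNumber K : ℝ) * regulator K := hlo
  · calc (classNumber K : ℝ) * regulator K ≤ 55 / 2 * Real.sqrt q * Real.log q ^ 2 *
          (1 / (η * Real.log q)) := hhi
      _ = 55 / 2 * Real.sqrt q * Real.log q / η := by field_simp

/-- **The sharper ceiling for quality `η ≥ 40`**: same `K`, `q ≥ 10⁴`; if `η ≥ 40` then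
`h_K R_K ≤ √q log q/(2η)` (upper half on the window `1/(40 log q)` with the kernel constant `1`).
[cite: TaoTeravainen2021, Definition 1.4] [cite: MontgomeryVaughan2007, §11.2 Theorem 11.4 (11.10)] -/
theorem classNumber_mul_regulator_le_of_isSiegelZero_of_forty_le (h2 : finrank ℚ K = 2)
    (hodd : Odd (NumberField.discr K)) (hd : 0 < NumberField.discr K)
    [NeZero (NumberField.discr K).natAbs] (hq : 10 ^ 4 ≤ (NumberField.discr K).natAbs) {η : ℝ}
    (hS : IsSiegelZero (jacobiChar (NumberField.discr K).natAbs) η) (h40 : 40 ≤ η) :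
    (classNumber K : ℝ) * regulator K ≤
      Real.sqrt (NumberField.discr K).natAbs * Real.log (NumberField.discr K).natAbs / (2 * η) := by
  set q : ℕ := (NumberField.discr K).natAbs with hqdef
  obtain ⟨-, -, -, hzero⟩ := hS
  have hL9 : 9 ≤ Real.log q := nine_le_log_of_ge hq
  have hL0 : 0 < Real.log q := by linarith
  have hη0 : 0 < η := by linarith
  set β : ℝ := 1 - 1 / (η * Real.log q) with hβdef
  have hκ : 1 - β = 1 / (η * Real.log q) := by rw [hβdef]; ring
  have hβ40 : 1 - 1 / (40 * Real.log q) ≤ β := by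
    have : 1 / (η * Real.log q) ≤ 1 / (40 * Real.log q) :=
      one_div_le_one_div_of_le (by positivity) (mul_le_mul_of_nonneg_right h40 hL0.le)
    rw [hβdef]; linarith
  have hhi := classNumber_mul_regulator_le_of_realZero_explicit h2 hodd hd (le_trans (by norm_num) hq)
    hβ40 hzero
  rw [hκ] at hhi
  calc (classNumber K : ℝ) * regulator K ≤ 1 / 2 * Real.sqrt q * Real.log q ^ 2 *
        (1 / (η * Real.log q)) := hhi
    _ = Real.sqrt q * Real.log q / (2 * η) := by field_simp

end Literature.NumberTheory.LFunctions

end
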